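import Literature.AlgebraicGeometry.AbelianSchemes.AbelianSchemeLDeltaOfLambda
import Literature.AlgebraicGeometry.AbelianSchemes.AbelianSchemeKOfLFibres
import Literature.AlgebraicGeometry.AbelianSchemes.IsLambdaOfAtMulAdd
import Literature.AlgebraicGeometry.AbelianSchemes.PoincareSheafBiadditiveNoetherian
import Literature.AlgebraicGeometry.AbelianSchemes.PoincareSheafBiadditiveAnyBase
import Literature.AlgebraicGeometry.AbelianVarieties.PhiPicTorsionDivisible
import Literature.AlgebraicGeometry.AbelianVarieties.HomogeneousLineBundleDivisor
import HarnessLib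

/-!
# `Λ(L)` is fibrewise `Λ(L_s)`; a square root in `Pic⁰`; and «`L ⊗ L^Δ(ν)⁻¹` lies in `Pic⁰` when `ν² = Λ(L)`»
# ([MumfordFogartyKirwan1994] Ch. 6 §2, Prop. 6.10 and the last step of the proof of Prop. 6.11)

Layer `Literature/AlgebraicGeometry/AbelianSchemes`, namespaces `Literature.AlgebraicGeometry.AbelianVarieties` (§2) and
`Literature.AlgebraicGeometry.AbelianSchemes.AbelianSchemeOver` (§1, §3).  THEOREMS ONLY (no definition, no named fact, no instance,
no notation, no `sorry`).  Cell `hodgecm-mathlib` (D-0151), F-DAG row F-2 (e) «MFK Prop. 6.11», brick B3a of the census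
`B-provers/B-p17/g12/CENSUS-F2e-MFK611.B-p17g12.md` (B-p17 (g12)); consumer: B3b, the closed locus «`L_T ≅ L^Δ_T(kμ)`»
(★ `RigidifiedTrivialityLocusClosed` wants the family `L ⊗ L^Δ(kμ)⁻¹` FIBREWISE IN `Pic⁰`).  HC_CM is proved only modulo the 7
printed citations until rung 0 closes; nothing here is about HC.

THE PRINT.  [MumfordFogartyKirwan1994] p. 123: on the closed subscheme `S₁` where `Λ(L) = 2kμ`, «`L` and `L^Δ(kμ)` define 2 sections
of `Pic(X/S)`».  In the tree `Pic(X/S)` is a dual pair `D = (Â, 𝒫)` (★ `DualPair`), which classifies RIGIDIFIED families lying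
FIBREWISE IN `Pic⁰`; so the difference `N := L ⊗ L^Δ(kμ)⁻¹` must be shown to lie in `Pic⁰` on every geometric fibre `A_s`.
Additively, `φ_{N_s} = Λ(L_s) − Λ(L^Δ(kμ)_s) = 2kμ̄ − (kμ̄ + kμ̄ᵗ)`, which vanishes because `Λ(L_s) = 2kμ̄` is symmetric and
`Hom(A_s, Â_s)` is torsion-free.  We avoid the transpose and prove it through the SQUARE: `N_s^{⊗2}` has class
`[L_s]²·[L^Δ(ν²)_s]⁻¹ = [L_s]²·[L^Δ(Λ(L))_s]⁻¹` (`ν = kμ`; `𝒫` is additive in the `Â`-variable, ★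
`nonempty_pullbackP_mul_iso_of_isLocallyNoetherian`), whose `φ` is `φ_{[L_s]}² · (φ_{Θ}²)⁻¹ = 1` by Prop. 6.10 at the point (★
`phiPic_pullback_graph_detClass_P`) for a divisor `Θ` of `L_s` witnessing `Λ(L)` at `s` (§1); and a class whose square lies in
`Pic⁰` lies in `Pic⁰` when `2 ∈ Ω^×` (§2: `φ` is a homomorphism on the divisible group `A_s(Ω)`, ★
`eq_one_of_forall_pow_eq_one_of_isAlgClosed`).

* §1 **`isLambdaOfAt_of_classify_mumfordBundle`** — «`Λ(L)` IS FIBREWISE `Λ(L_s)`»: if `lam : A → Â` classifies the Mumford family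
  of `L` (hypothesis (ii) of ★ `exists_isMonHom_classify_mumfordBundle`: `(1_A × (u ≫ lam))^*𝒫 ≅ Λ(L)|_u` for all `u`) and `Θ` is a
  Cartier divisor on the fibre `A_s` with `[L|_{A_s}] = [Θ]`, then `lam̄ = Λ(𝒪(Θ))` at `s` (★ `IsLambdaOfAt`);
  `exists_isLambdaOfAt_of_classify_mumfordBundle` — such a `Θ` exists (★ `exists_iso_lineBundle_toUnitCocycle`).
* §2 **`AbelianVarieties.isHomogeneous_of_isHomogeneous_tensorObj_self`** — on an abelian variety over an algebraically closed
  field with `2 ≠ 0`, a rank-one `E` with `E ⊗ E ∈ Pic⁰` lies in `Pic⁰`.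
* §3 **`isHomogeneous_tensor_dual_pullback_graph`** — THE CORE: for a geometric point `s`, `j = ι_s : A_s → A` and an
  `A_s`-valued point `G` of `Â` over `S` with `G·G = ι_s ≫ lam` in `Hom_S(A_s, Â)` («`ν̄² = Λ(L)` on the fibre»), the rank-one
  module `ι_s^*L ⊗ ((ι_s, G)^*𝒫)⁻¹` on `A_s` is HOMOGENEOUS (`∈ Pic⁰`) — ANY locally Noetherian base (ed. 2; ed. 1 assumed `S`
  connected, only through the biadditivity of `𝒫`, now ★ `PoincareSheafBiadditiveAnyBase`), unit hypothesis `hD`.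

## References
* [MumfordFogartyKirwan1994] D. Mumford, J. Fogarty, F. Kirwan, *Geometric Invariant Theory*, 3rd ed. (1994), Ch. 6 §2
  Definition 6.2 (p. 120), Prop. 6.10 (p. 121), Prop. 6.11 (p. 122; proof pp. 122–123).
* [MumfordAV1970] D. Mumford, *Abelian Varieties* (1970), §8 (pp. 74–75), §13 (p. 123).
* [MilneAV2008] J. S. Milne, *Abelian Varieties* (v2.00, 2008), I §8 pp. 36–37.
-/

-- `Scheme.Modules` / `SheafOfModules` are not reducible (as in Mathlib's `AlgebraicGeometry/Modules/Sheaf.lean`).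
set_option backward.isDefEq.respectTransparency false

noncomputable section

open CategoryTheory CategoryTheory.Limits AlgebraicGeometry MonoidalCategory CartesianMonoidalCategory
open scoped MonObj

universe u

/-! ## §2 (first, field level) A square root in `Pic⁰` -/

namespace Literature.AlgebraicGeometry.AbelianVarieties

open Literature.AlgebraicGeometry.Motives Literature.AlgebraicGeometry.Modules

/-- **A rank-one module whose tensor square lies in `Pic⁰` lies in `Pic⁰`** (abelian variety over an algebraically closed field
in which `2 ≠ 0`): `φ_{[E]}(x)² = φ_{[E ⊗ E]}(x) = 1` for all `x`, and `φ_{[E]}` is a homomorphism on the `2`-divisible group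
`A(Ω)` (★ `phiPicHom`, theorem of the square), hence trivial (★ `eq_one_of_forall_pow_eq_one_of_isAlgClosed`); `φ_{[E]} ≡ 1` is
homogeneity (★ `isHomogeneous_iff_forall_pullback_detClass_eq`). [cite: MumfordAV1970, §8 (pp. 74–75)] -/
theorem isHomogeneous_of_isHomogeneous_tensorObj_self {Ω : Type u} [Field Ω] [IsAlgClosed Ω] (A : AbelianVariety Ω)
    {E : A.X.left.Modules} (hE : HasRank E 1) (h2 : (2 : Ω) ≠ 0) (h : IsHomogeneous A (tensorObj E E)) :
    IsHomogeneous A E := by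
  have hE₁ : IsFiniteLocallyFree E := HasRank.isFiniteLocallyFree' hE
  have hEE : HasRank (tensorObj E E) 1 := hasRank_tensorObj_one hE hE
  have hEE₁ : IsFiniteLocallyFree (tensorObj E E) := HasRank.isFiniteLocallyFree' hEE
  rw [isHomogeneous_iff_forall_pullback_detClass_eq A hEE hEE₁] at h
  rw [isHomogeneous_iff_forall_pullback_detClass_eq A hE hE₁]
  intro P
  rw [← phiPic_eq_one_iff]
  have hsq : ∀ Q : A.Points Ω, phiPic A (detClass hE₁) Q ^ 2 = 1 := by
    intro Q
    have hQ := h Q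
    rw [← phiPic_eq_one_iff, detClass_tensorObj_of_hasRank_one hE hE hE₁ hE₁ hEE₁, phiPic_mul_class] at hQ
    rw [pow_two]
    exact hQ
  have h2' : ((2 : ℕ) : Ω) ≠ 0 := by exact_mod_cast h2
  have key := eq_one_of_forall_pow_eq_one_of_isAlgClosed A (phiPicHom A A.theoremOfTheSquare_holds (detClass hE₁)) h2'
    (fun Q => by rw [phiPicHom_apply]; exact hsq Q) P
  rwa [phiPicHom_apply] at key

end Literature.AlgebraicGeometry.AbelianVarieties

namespace Literature.AlgebraicGeometry.AbelianSchemes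

open Literature.AlgebraicGeometry.Motives Literature.AlgebraicGeometry.Modules
  Literature.AlgebraicGeometry.AbelianVarieties

namespace AbelianSchemeOver

variable {S : Scheme.{u}} (A : AbelianSchemeOver S) (D : A.DualPair) {L : A.left.Modules} (hL : HasRank L 1)
  (lam : A.X ⟶ D.hat.X)
  (hlam : ∀ ⦃T : Over S⦄ (u : T ⟶ A.X),
    Nonempty (D.pullbackP T.hom (u ≫ lam).left (Over.w _) ≅
      (Scheme.Modules.pullback (A.X ◁ u).left).obj (A.mumfordBundle L)))
  {Ω : Type u} [Field Ω] (s : Spec (.of Ω) ⟶ S)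

/-! ## §1 The classifying morphism of `Λ(L)` is fibrewise `Λ(L_s)` -/

section FibreWitness

include hlam in
/-- **`Λ(L)` IS FIBREWISE `Λ(L_s)`.**  If `lam : A → Â` classifies the Mumford family of a rank-one `L` on `A` —
`(1_A × (u ≫ lam))^*𝒫 ≅ (1_A × u)^*Λ(L)` for every `S`-scheme `T` and every `u : T → A`, hypothesis (ii) of ★
`exists_isMonHom_classify_mumfordBundle` ([MumfordFogartyKirwan1994] Def. 6.2 «`Λ(L) : X → X̂`») — and `Θ` is a Cartier divisor on
the fibre `A_s` over a field-valued point `s` with `[L|_{A_s}] = [Θ]` in `Ȟ¹(A_s, 𝒪^×)`, then `lam̄ = Λ(𝒪(Θ))` at `s` (★ `IsLambdaOfAt`: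
`𝒫|_{A_s × {lam̄(P)}} ≅ t_P^*𝒪(Θ) ⊗ 𝒪(Θ)⁻¹` for every `Ω`-point `P`).  Proof in `Ȟ¹(A_s, 𝒪^×)` (rank-one modules are classified by
their class, ★ `nonempty_iso_iff_detClass_eq`): the slice at `lam̄(P)` is `(1_A × (u_P ≫ lam))^*𝒫` (★ `sliceAt_obj_eq_pullbackP`), by
(ii) its class is `(1_A × u_P)^*[Λ(L)] = t_P^*[L_s]·[L_s]⁻¹` (★ `pullback_whiskerLeft_mumfordClass_homMk`), and the right side has
class `t_P^*[Θ]·[Θ]⁻¹` (★ `detClass_translationPullback_tensor_dual`). [cite: MumfordFogartyKirwan1994, Ch. 6 §2 Definition 6.2 (p. 120)]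
[cite: MumfordAV1970, §8 (pp. 74–75) and §13 (p. 123)] [cite: MilneAV2008, I §8 pp. 36–37] -/
theorem isLambdaOfAt_of_classify_mumfordBundle {Θ : CartierDivisor (A.fibre s).toAbelianVariety.X.left}
    (hLΘ : CechPic.pullback (X := (A.fibre s).toAbelianVariety.X.left) (pullback.fst A.X.hom s)
      (detClass (HasRank.isFiniteLocallyFree' hL)) = Θ.cechClass) :
    A.IsLambdaOfAt s D lam Θ := by
  intro P
  have hP : IsFiniteLocallyFree D.P := HasRank.isFiniteLocallyFree' D.hasRank_one
  have hΘ₁ : HasRank (A.lineBundleOfDivisor s Θ) 1 := A.hasRank_lineBundleOfDivisor s Θ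
  have hR : HasRank (tensorObj
      ((Scheme.Modules.pullback ((A.fibre s).toAbelianVariety.translation P).left).obj (A.lineBundleOfDivisor s Θ))
      (Modules.dual (A.lineBundleOfDivisor s Θ))) 1 :=
    hasRank_tensorObj_one (hasRank_pullback _ hΘ₁) (hasRank_dual hΘ₁)
  have hfl := HasRank.isFiniteLocallyFree' hR
  refine (nonempty_iso_iff_detClass_eq (hasRank_pullback _ D.hasRank_one) hR (hP.pullback _) hfl).2 ?_
  rw [A.detClass_translationPullback_tensor_dual s Θ P hfl, detClass_pullback _ hP]
  -- the slice is the Mumford family along `u_P`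
  obtain ⟨i⟩ := hlam (Over.homMk (A.fibrePointToLeft s P) (A.fibrePointToLeft_comp_hom s P) : Over.mk s ⟶ A.X)
  have hv : A.valueAt s D lam P =
      ((Over.homMk (A.fibrePointToLeft s P) (A.fibrePointToLeft_comp_hom s P) : Over.mk s ⟶ A.X) ≫ lam).left :=
    A.valueAt_eq_homMk_comp_left D s lam P
  have e₁ : (Scheme.Modules.pullback (A.sliceAt s D lam P)).obj D.P =
      D.pullbackP s ((Over.homMk (A.fibrePointToLeft s P) (A.fibrePointToLeft_comp_hom s P) : Over.mk s ⟶ A.X) ≫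
        lam).left (Over.w _) := by
    rw [sliceAt_obj_eq_pullbackP]
    exact D.pullbackP_congr s hv _ _
  have hΛ : IsFiniteLocallyFree (A.mumfordBundle L) := HasRank.isFiniteLocallyFree' (A.hasRank_mumfordBundle hL)
  have e₂ : CechPic.pullback (A.sliceAt s D lam P) (detClass hP) =
      detClass (hΛ.pullback (A.X ◁ (Over.homMk (A.fibrePointToLeft s P) (A.fibrePointToLeft_comp_hom s P) :
        Over.mk s ⟶ A.X)).left) := by
    rw [← detClass_pullback _ hP]
    exact detClass_eq_of_iso (eqToIso e₁ ≪≫ i) _ _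
  refine e₂.trans ?_
  rw [detClass_pullback _ hΛ, A.detClass_mumfordBundle hL hΛ, A.pullback_whiskerLeft_mumfordClass_homMk s _ P, ← hLΘ]
  rfl

include hlam in
/-- **A divisor of `L_s` witnesses `Λ(L)` at `s`**: there is a Cartier divisor `Θ` on `A_s` with `L|_{A_s} ≅ 𝒪(Θ)` (★
`exists_iso_lineBundle_toUnitCocycle`: every rank-one module on the integral `A_s` is an `𝒪(Θ)`) and `lam̄ = Λ(𝒪(Θ))` at `s`.
[cite: MumfordFogartyKirwan1994, Ch. 6 §2 Definition 6.2 (p. 120)] [cite: MumfordAV1970, §8 (pp. 74–75)] -/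
theorem exists_isLambdaOfAt_of_classify_mumfordBundle :
    ∃ Θ : CartierDivisor (A.fibre s).toAbelianVariety.X.left,
      Nonempty ((Scheme.Modules.pullback (X := (A.fibre s).toAbelianVariety.X.left) (pullback.fst A.X.hom s)).obj L ≅
          A.lineBundleOfDivisor s Θ) ∧
        CechPic.pullback (X := (A.fibre s).toAbelianVariety.X.left) (pullback.fst A.X.hom s)
          (detClass (HasRank.isFiniteLocallyFree' hL)) = Θ.cechClass ∧
        A.IsLambdaOfAt s D lam Θ := by
  obtain ⟨Θ, ⟨e⟩⟩ := exists_iso_lineBundle_toUnitCocycle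
    (hasRank_pullback (Y := (A.fibre s).toAbelianVariety.X.left) (pullback.fst A.X.hom s) hL)
  have hLΘ := A.cechPic_pullback_fst_detClass_eq_of_iso s hL (Θ := Θ) e
  exact ⟨Θ, ⟨e⟩, hLΘ, A.isLambdaOfAt_of_classify_mumfordBundle D hL lam hlam s hLΘ⟩

end FibreWitness

/-! ## §3 THE CORE: `ι_s^*L ⊗ ((ι_s, G)^*𝒫)⁻¹ ∈ Pic⁰(A_s)` when `G·G = ι_s ≫ Λ(L)` -/

section Core

variable [IsLocallyNoetherian S]
  (hD : Nonempty ((Scheme.Modules.pullback (DualPair.unitHatSlice D)).obj D.P ≅ SheafOfModules.unit _))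

/-- `Ȟ¹` is functorial: `(f ≫ g)^* = f^* ∘ g^*` (private restatement for the module-free classes used below).
[cite: Hartshorne1977, II Ex. 6.8 (a)] -/
private theorem cechPic_pullback_comp₀ {X Y Z : Scheme.{u}} (f : X ⟶ Y) (g : Y ⟶ Z) (c : CechPic Z) :
    CechPic.pullback (f ≫ g) c = CechPic.pullback f (CechPic.pullback g c) :=
  CechPic.pullback_comp f g c

include hD in
/-- **The class of `(ι_s, G)^*𝒫` squares to the class of `(ι_s, G·G)^*𝒫`** — additivity of the Poincaré sheaf in the `Â`-variable
(★ `nonempty_pullback_whiskerLeft_mul_iso_tensor`, biadditivity over ANY locally Noetherian base, [MumfordAV1970] §8) pulled back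
along the section `(ι_s, 1) : A_s → A ×_S A_s`.  (Ed. 2: the base `S` is no longer assumed connected.)
[cite: MumfordAV1970, §8 (pp. 74–75)] [cite: MilneAV2008, I §8 pp. 36–37] -/
theorem cechPic_pullback_graph_mul_detClass_P (G₁ G₂ : Over.mk (pullback.fst A.X.hom s ≫ A.X.hom) ⟶ D.hat.X)
    (gr₁ gr₂ gr₁₂ : (A.fibre s).toAbelianVariety.X.left ⟶ A.prodLeft D.hat)
    (h₁ : gr₁ ≫ pullback.fst A.X.hom D.hat.X.hom = pullback.fst A.X.hom s)
    (h₁' : gr₁ ≫ pullback.snd A.X.hom D.hat.X.hom = G₁.left)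
    (h₂ : gr₂ ≫ pullback.fst A.X.hom D.hat.X.hom = pullback.fst A.X.hom s)
    (h₂' : gr₂ ≫ pullback.snd A.X.hom D.hat.X.hom = G₂.left)
    (h₁₂ : gr₁₂ ≫ pullback.fst A.X.hom D.hat.X.hom = pullback.fst A.X.hom s)
    (h₁₂' : gr₁₂ ≫ pullback.snd A.X.hom D.hat.X.hom = (G₁ * G₂).left) :
    CechPic.pullback gr₁₂ (detClass (HasRank.isFiniteLocallyFree' D.hasRank_one)) =
      CechPic.pullback gr₁ (detClass (HasRank.isFiniteLocallyFree' D.hasRank_one)) *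
        CechPic.pullback gr₂ (detClass (HasRank.isFiniteLocallyFree' D.hasRank_one)) := by
  have hP : IsFiniteLocallyFree D.P := HasRank.isFiniteLocallyFree' D.hasRank_one
  -- the base `T = A_s` (over `S` through `ι_s ≫ π`) and the section `δ = (ι_s, 1) : A_s → A ×_S A_s`
  let T : Over S := Over.mk (pullback.fst A.X.hom s ≫ A.X.hom)
  let δ : (A.fibre s).toAbelianVariety.X.left ⟶ (A.baseChange T.hom).left :=
    pullback.lift (pullback.fst A.X.hom s) (𝟙 _) (by simp [T])
  have hδ₁ : δ ≫ pullback.fst A.X.hom T.hom = pullback.fst A.X.hom s := pullback.lift_fst _ _ _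
  have hδ₂ : δ ≫ pullback.snd A.X.hom T.hom = 𝟙 _ := pullback.lift_snd _ _ _
  -- `(ι_s, g) = δ ≫ (1_A × g)`
  have hgr : ∀ (g : T ⟶ D.hat.X) (gr : (A.fibre s).toAbelianVariety.X.left ⟶ A.prodLeft D.hat),
      gr ≫ pullback.fst A.X.hom D.hat.X.hom = pullback.fst A.X.hom s →
      gr ≫ pullback.snd A.X.hom D.hat.X.hom = g.left →
        gr = δ ≫ A.baseChangeToProd D.hat T.hom g.left (Over.w g) := by
    intro g gr hg hg'
    apply pullback.hom_ext
    · rw [hg, Category.assoc, A.baseChangeToProd_fst, hδ₁]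
    · rw [hg', Category.assoc, A.baseChangeToProd_snd, ← Category.assoc, hδ₂, Category.id_comp]
  -- classes of `δ^*(1_A × g)^*𝒫`
  have hcl : ∀ (g : T ⟶ D.hat.X) (gr : (A.fibre s).toAbelianVariety.X.left ⟶ A.prodLeft D.hat),
      gr ≫ pullback.fst A.X.hom D.hat.X.hom = pullback.fst A.X.hom s →
      gr ≫ pullback.snd A.X.hom D.hat.X.hom = g.left →
        CechPic.pullback gr (detClass hP) =
          CechPic.pullback δ (detClass ((hP.pullback (A.baseChangeToProd D.hat T.hom g.left (Over.w g))))) := by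
    intro g gr hg hg'
    rw [hgr g gr hg hg', cechPic_pullback_comp₀, detClass_pullback _ hP]
  obtain ⟨I⟩ := D.nonempty_pullback_whiskerLeft_mul_iso_tensor hD (T := T) G₁ G₂
  rw [← D.pullbackP_eq_pullback_whiskerLeft, ← D.pullbackP_eq_pullback_whiskerLeft,
    ← D.pullbackP_eq_pullback_whiskerLeft] at I
  have h12 := detClass_eq_of_iso I (hP.pullback _)
    (isFiniteLocallyFree_tensorObj _ _ (hP.pullback _) (hP.pullback _))
  rw [detClass_tensorObj_of_hasRank_one (hasRank_pullback _ D.hasRank_one) (hasRank_pullback _ D.hasRank_one)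
    (hP.pullback _) (hP.pullback _)] at h12
  rw [hcl (G₁ * G₂) gr₁₂ h₁₂ h₁₂', hcl G₁ gr₁ h₁ h₁', hcl G₂ gr₂ h₂ h₂', ← map_mul]
  exact congrArg (CechPic.pullback δ) h12

include hL hD hlam in
/-- **THE CORE OF [MumfordFogartyKirwan1994] Prop. 6.11's last step: `ι_s^*L ⊗ ((ι_s, G)^*𝒫)⁻¹ ∈ Pic⁰(A_s)` when `G·G = ι_s ≫ Λ(L)`.**
For an abelian scheme `A/S` over a locally Noetherian base (ed. 2: connectedness dropped) with a dual pair `D` (unit hypothesis `hD`), a rank-one `L`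
on `A` whose Mumford family is classified by `lam` (hypothesis (ii)), a geometric point `s` with `2 ∈ Ω^×`, and an `A_s`-valued
point `G` of `Â` over `S` with `G·G = ι_s ≫ lam` in the group `Hom_S(A_s, Â)` — e.g. `G = ι_s ≫ ν` for a homomorphism `ν` with
`ν² = lam`, the `kμ` of Prop. 6.11 — the rank-one module `ι_s^*L ⊗ ((ι_s, G)^*𝒫)^∨` on the fibre `A_s` is HOMOGENEOUS.  Proof: its
tensor square has class `[L_s]²·[(ι_s, G·G)^*𝒫]⁻¹ = [L_s]²·[(ι_s, lam∘ι_s)^*𝒫]⁻¹` (`cechPic_pullback_graph_mul_detClass_P`), whose `φ`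
is `φ_{[L_s]}²·(φ_Θ²)⁻¹ = 1` for a divisor `Θ` of `L_s` witnessing `lam` (§1, ★ `phiPic_pullback_graph_detClass_P` = Prop. 6.10 at
`s`); conclude by §2. [cite: MumfordFogartyKirwan1994, Ch. 6 §2 Prop. 6.11 (p. 122; proof pp. 122–123) and Prop. 6.10 (p. 121)]
[cite: MumfordAV1970, §8 (pp. 74–75)] -/
theorem isHomogeneous_tensor_dual_pullback_graph [IsAlgClosed Ω] (h2 : (2 : Ω) ≠ 0)
    (G : Over.mk (pullback.fst A.X.hom s ≫ A.X.hom) ⟶ D.hat.X)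
    (hG : G * G = (Over.homMk (pullback.fst A.X.hom s) rfl : Over.mk (pullback.fst A.X.hom s ≫ A.X.hom) ⟶ A.X) ≫ lam)
    (gr : (A.fibre s).toAbelianVariety.X.left ⟶ A.prodLeft D.hat)
    (hgr₁ : gr ≫ pullback.fst A.X.hom D.hat.X.hom = pullback.fst A.X.hom s)
    (hgr₂ : gr ≫ pullback.snd A.X.hom D.hat.X.hom = G.left) :
    IsHomogeneous (A.fibre s).toAbelianVariety
      (tensorObj ((Scheme.Modules.pullback (X := (A.fibre s).toAbelianVariety.X.left) (pullback.fst A.X.hom s)).obj L)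
        (Modules.dual ((Scheme.Modules.pullback gr).obj D.P))) := by
  have hP : IsFiniteLocallyFree D.P := HasRank.isFiniteLocallyFree' D.hasRank_one
  -- a divisor `Θ` of `L_s` witnessing `lam`
  obtain ⟨Θ, -, hLΘ, hΛ⟩ := A.exists_isLambdaOfAt_of_classify_mumfordBundle D hL lam hlam s
  -- ranks
  have hLs : HasRank ((Scheme.Modules.pullback (X := (A.fibre s).toAbelianVariety.X.left) (pullback.fst A.X.hom s)).obj L) 1 :=
    hasRank_pullback _ hL
  have hGP : HasRank ((Scheme.Modules.pullback gr).obj D.P) 1 := hasRank_pullback _ D.hasRank_one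
  have hGPd : HasRank (Modules.dual ((Scheme.Modules.pullback gr).obj D.P)) 1 := hasRank_dual hGP
  have hM : HasRank (tensorObj
      ((Scheme.Modules.pullback (X := (A.fibre s).toAbelianVariety.X.left) (pullback.fst A.X.hom s)).obj L)
      (Modules.dual ((Scheme.Modules.pullback gr).obj D.P))) 1 := hasRank_tensorObj_one hLs hGPd
  refine isHomogeneous_of_isHomogeneous_tensorObj_self (A.fibre s).toAbelianVariety hM h2 ?_
  -- the graph `(ι_s, G·G) = (ι_s, lam ∘ ι_s)`
  let gr₂ : (A.fibre s).toAbelianVariety.X.left ⟶ A.prodLeft D.hat :=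
    pullback.lift (pullback.fst A.X.hom s) (G * G).left (by rw [Over.w]; rfl)
  have hgr₂₁ : gr₂ ≫ pullback.fst A.X.hom D.hat.X.hom = pullback.fst A.X.hom s := pullback.lift_fst _ _ _
  have hgr₂₂ : gr₂ ≫ pullback.snd A.X.hom D.hat.X.hom = (G * G).left := pullback.lift_snd _ _ _
  have hgr₂₂' : gr₂ ≫ pullback.snd A.X.hom D.hat.X.hom = pullback.fst A.X.hom s ≫ lam.left := by
    rw [hgr₂₂, hG, Over.comp_left]
    rfl
  -- classes
  have hsq := A.cechPic_pullback_graph_mul_detClass_P D s hD G G gr gr gr₂ hgr₁ hgr₂ hgr₁ hgr₂ hgr₂₁ hgr₂₂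
  have hφ₂ := fun x => A.phiPic_pullback_graph_detClass_P D s rfl hΛ hP gr₂ hgr₂₁ hgr₂₂' x
  -- homogeneity of the square, read in classes
  have hMM : HasRank (tensorObj (tensorObj
      ((Scheme.Modules.pullback (X := (A.fibre s).toAbelianVariety.X.left) (pullback.fst A.X.hom s)).obj L)
      (Modules.dual ((Scheme.Modules.pullback gr).obj D.P))) (tensorObj
      ((Scheme.Modules.pullback (X := (A.fibre s).toAbelianVariety.X.left) (pullback.fst A.X.hom s)).obj L)
      (Modules.dual ((Scheme.Modules.pullback gr).obj D.P)))) 1 := hasRank_tensorObj_one hM hM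
  rw [isHomogeneous_iff_forall_pullback_detClass_eq _ hMM (HasRank.isFiniteLocallyFree' hMM)]
  intro x
  rw [← phiPic_eq_one_iff, detClass_tensorObj_of_hasRank_one' hM hM,
    detClass_tensorObj_of_hasRank_one hLs hGPd (HasRank.isFiniteLocallyFree' hLs) (HasRank.isFiniteLocallyFree' hGPd)
      (HasRank.isFiniteLocallyFree' hM),
    detClass_dual' (HasRank.isFiniteLocallyFree' hGP) (HasRank.isFiniteLocallyFree' hGPd),
    (detClass_eq_of_iso (Iso.refl _) (HasRank.isFiniteLocallyFree' hGP) (hP.pullback gr)).trans (detClass_pullback gr hP),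
    (detClass_eq_of_iso (Iso.refl _) (HasRank.isFiniteLocallyFree' hLs)
      ((HasRank.isFiniteLocallyFree' hL).pullback (pullback.fst A.X.hom s))).trans
      (detClass_pullback _ (HasRank.isFiniteLocallyFree' hL)), hLΘ]
  -- `φ` of `([Θ]·c⁻¹)² = [Θ]²·(c·c)⁻¹ = [Θ]²·c₂⁻¹`
  have e : (Θ.cechClass * (CechPic.pullback gr (detClass hP))⁻¹) * (Θ.cechClass * (CechPic.pullback gr (detClass hP))⁻¹) =
      Θ.cechClass * Θ.cechClass * (CechPic.pullback gr₂ (detClass hP))⁻¹ := by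
    rw [hsq, mul_inv]
    simp only [mul_assoc, mul_left_comm, mul_comm]
  rw [e, phiPic_mul_class, phiPic_mul_class, ← pow_two]
  -- `φ_{c₂⁻¹} = (φ_{c₂})⁻¹ = (φ_Θ²)⁻¹`
  have hinv : phiPic (A.fibre s).toAbelianVariety (CechPic.pullback gr₂ (detClass hP))⁻¹ x =
      (phiPic (A.fibre s).toAbelianVariety Θ.cechClass x ^ 2)⁻¹ := by
    rw [← hφ₂ x]
    have hm := phiPic_mul_class (A.fibre s).toAbelianVariety (CechPic.pullback gr₂ (detClass hP))
      (CechPic.pullback gr₂ (detClass hP))⁻¹ x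
    rw [mul_inv_cancel, phiPic_one_class] at hm
    exact eq_inv_of_mul_eq_one_right hm.symm
  rw [hinv, mul_inv_cancel]

end Core

end AbelianSchemeOver

end Literature.AlgebraicGeometry.AbelianSchemes

end
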